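import Summits.Schanuel.Schanuel.Theorems.DiophantineDichotomyApproximationPropertyDefs

/-!
# STUB-PLAN `CycleAPIAt3 : CycleAPIAt 3` — merged helper SIGNATURES (stub-critic)

Crux stmt-Schanuel-6117 `ApproximationProperty`, line `orbit-interpolation-determinant`, skeleton v7.
Planner `planner-scrit-stmt-Schanuel-6117-CycleAPIAt3-0`, 2026-08-16.  Statements only (`sorry`);
the plan is `Cruxes/ApproximationProperty/STUB-PLAN-CycleAPIAt3.md`.  Every constant below is an existing
declaration (`Rx`, `ideg`, `iheight`, `iabs`, `projDist`, `projZeros`, `rho`, `IsUnmixedOfRank`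
from `Literature.NumberTheory.Transcendental.Nesterenko`; `CycleAPIAt` from `…ApproximationPropertyDefs`).

Merge map: P0a = k1 H1 = k2 H0b = k3 L1 · P0b = k1 H6 · P1 = the lead's W3 descent with its data kept ·
P2 = k1 H3 ⊕ k2 H2/H3 (coordinate chart + fibre bound: no `D² log D`, hence no log-window) ·
P3 = k1 H7 (lines: k2 H4b) · P4 = k1 H4 (restated for `a + b ≤ 3Δ`) · P5 = k1 H5 as a NAMED FACT ·
P6 = the residual every ideator found (k1 (C) = k2 (R) = k3 hole X = lead c2 branch β), typed ·
P7 = k2's `LineRestart` shape, generalised to satellites of degree `≤ δ⋆`.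
-/

set_option linter.dupNamespace false

noncomputable section

attribute [local instance] MvPolynomial.gradedAlgebra

namespace Summit.Schanuel.Schanuel.Cruxes.ApproximationProperty.OrbitInterpolationDeterminant
namespace StubPlanCycleAPIAt3

open Literature.NumberTheory.Transcendental.Nesterenko MvPolynomial
open scoped BigOperators

/-! ## Tier 0 — trunk (S) -/

/-- **P0a `clause_mono_level`** (XS; k1 H1 = k2 H0b = k3 L1).  `H_𝔭` is non-decreasing
(`hilbert_mono_of_isPrime`, …HilbertTruncation) and `≤ ideg 𝔭 1` (`finrank_homogeneousSubmodule_le`,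
…ClauseFree), so the clause at level `δ` gives the clause at every `δ' ≥ δ`. -/
theorem clause_mono_level (m : ℕ) (𝔭 : Ideal (Rx m)) (h𝔭 : 𝔭.IsPrime)
    (hhom : 𝔭.IsHomogeneous (homogeneousSubmodule (Fin (m + 1)) ℚ)) (hr : IsUnmixedOfRank 𝔭 1)
    {δ δ' : ℕ} (hδ : δ ≤ δ')
    (h : Module.finrank ℚ ↥(homogeneousSubmodule (Fin (m + 1)) ℚ δ) =
      Module.finrank ℚ ↥(homogeneousSubmodule (Fin (m + 1)) ℚ δ ⊓ 𝔭.restrictScalars ℚ) + ideg 𝔭 1) :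
    Module.finrank ℚ ↥(homogeneousSubmodule (Fin (m + 1)) ℚ δ') =
      Module.finrank ℚ ↥(homogeneousSubmodule (Fin (m + 1)) ℚ δ' ⊓ 𝔭.restrictScalars ℚ) +
        ideg 𝔭 1 := by
  sorry

/-- **P0b `satellite_dichotomy`** (S; k1 H6, pure commutative algebra).  An orbit `𝔭 ⊇ (Q, P, T)` on
the complete-intersection curve `(Q, P)` is either a MINIMAL prime of `(Q,P,T)` (isolated points →
P5) or sits above a SATELLITE: a rank-2 homogeneous minimal prime `𝔮'` of `(Q,P)` with
`(Q,P,T) ≤ 𝔮' < 𝔭` (→ P7 or P6).  (`Ideal.exists_minimalPrimes_le`; Krull-dimension sandwich via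
`ringKrullDim_quotient_QP` / `spaceCI_unmixed`; `isHomogeneous_of_mem_associatedPrimes` +
`mem_associatedPrimes_of_mem_minimalPrimes`.) -/
theorem satellite_dichotomy (Q P T : Rx 3) (a b τ : ℕ) (hQ0 : Q ≠ 0) (hQ : Q.IsHomogeneous a)
    (hP : P.IsHomogeneous b) (hT : T.IsHomogeneous τ) (ha : 1 ≤ a) (hb : 1 ≤ b) (hτ : 1 ≤ τ)
    (hprime : (Ideal.span {Q}).IsPrime) (hPQ : P ∉ Ideal.span {Q})
    (𝔭 : Ideal (Rx 3)) (h𝔭 : 𝔭.IsPrime) (hhom : 𝔭.IsHomogeneous (homogeneousSubmodule (Fin (3 + 1)) ℚ))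
    (hr : IsUnmixedOfRank 𝔭 1) (hle : Ideal.span {Q} ⊔ Ideal.span {P} ⊔ Ideal.span {T} ≤ 𝔭) :
    𝔭 ∈ (Ideal.span {Q} ⊔ Ideal.span {P} ⊔ Ideal.span {T}).minimalPrimes ∨
    ∃ 𝔮' : Ideal (Rx 3), 𝔮'.IsPrime ∧ 𝔮'.IsHomogeneous (homogeneousSubmodule (Fin (3 + 1)) ℚ) ∧
      IsUnmixedOfRank 𝔮' 2 ∧ 𝔮' ∈ (Ideal.span {Q} ⊔ Ideal.span {P}).minimalPrimes ∧
      Ideal.span {Q} ⊔ Ideal.span {P} ⊔ Ideal.span {T} ≤ 𝔮' ∧ 𝔮' < 𝔭 := by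
  sorry

/-! ## Tier 1 — P1: the clause-free descent WITH its construction data (lead's W3, enriched) -/

/-- **P1 `CycleAP3Data`** — the lead's clause-free `t = 3` descent (`smallPrimeCurve3_of` →
`cycleAP3Prime_of_curve`, registered) with the construction data KEPT instead of discarded: the small
prime surface `Q` (`a ≤ Δ`), the second cut `P` (`b ≤ 2Δ`, `P ∉ (Q)`), the selected prime curve
`𝔮₂ ∋ Q, P`, the third cut `T ∉ 𝔮₂` (`τ ≤ 4Δ`), and the selected prime orbit `𝔭 ⊇ 𝔮₂ + (T)` with the
`CycleAP3Prime` budgets/accuracy at constant `c`.  (`small_prime_of_cut` already returns `𝔭 ≤ 𝔮` and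
`P ∈ 𝔮`; this is bookkeeping on top of the in-flight W3 files, not new mathematics.) -/
def CycleAP3Data : Prop :=
  ∀ ω : Fin 3 → ℂ, ∃ c : ℝ, 1 ≤ c ∧ ∀ Δ Y : ℝ, c ≤ Δ → Δ ≤ Y →
    ∃ (Q : Rx 3) (a : ℕ) (P : Rx 3) (b : ℕ) (𝔮₂ : Ideal (Rx 3)) (T : Rx 3) (τ : ℕ)
      (𝔭 : Ideal (Rx 3)),
      Q ≠ 0 ∧ Q.IsHomogeneous a ∧ 1 ≤ a ∧ (a : ℝ) ≤ Δ ∧ (Ideal.span {Q}).IsPrime ∧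
      P.IsHomogeneous b ∧ 1 ≤ b ∧ (b : ℝ) ≤ 2 * Δ ∧ P ∉ Ideal.span {Q} ∧
      𝔮₂.IsPrime ∧ 𝔮₂.IsHomogeneous (homogeneousSubmodule (Fin (3 + 1)) ℚ) ∧
      IsUnmixedOfRank 𝔮₂ 2 ∧ Q ∈ 𝔮₂ ∧ P ∈ 𝔮₂ ∧
      T.IsHomogeneous τ ∧ 1 ≤ τ ∧ (τ : ℝ) ≤ 4 * Δ ∧ T ∉ 𝔮₂ ∧
      𝔭.IsPrime ∧ 𝔭.IsHomogeneous (homogeneousSubmodule (Fin (3 + 1)) ℚ) ∧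
      IsUnmixedOfRank 𝔭 1 ∧ 𝔮₂ ≤ 𝔭 ∧ T ∈ 𝔭 ∧
      (ideg 𝔭 1 : ℝ) ≤ (c * Δ) ^ 3 ∧ iheight 𝔭 1 ≤ c * Y * Δ ^ 2 ∧
      iabs 𝔭 1 (Fin.cons 1 ω) ≤ Real.exp (-((Δ * iheight 𝔭 1 + Y * ideg 𝔭 1) / c))

theorem stub_cycleAP3Data : CycleAP3Data := by
  sorry

/-! ## Tier 1 — P2: the ORBIT FLOOR (load-bearing new lemma; k1 H3 ⊕ k2 H2/H3, chart version) -/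

/-- **P2 `OrbitFloor`** (M–L, ≈ 2 prover cycles, splits into 4 files).  A prime orbit `𝔭` lying on a
`ℚ`-curve `V(𝔮)` (`𝔮 ≤ 𝔭`, `𝔮` prime of rank 2, `δₛ = ideg 𝔮 2`) all of whose points stay at
projective distance `≥ e^{−L}` from `ω̄ = (1 : ω)` cannot be much smaller at `ω̄` than that allows:
`log (1/|𝔭(ω̄)|) ≤ C · (δₛ·L + h(𝔭) + D log(D+2) + √(D (h(𝔭) + D) L))`, `D = deg 𝔭`.
NO `D² log D` term (this is what closes k14's window and dissolves k3's hole U).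
Proof route: chart `i = argmax |ω̄ᵢ|`; `y = b_j/b_i` for a `j` with the norm form
`N(bᵢxⱼ − bⱼxᵢ) ∉ 𝔮` (exists: three such norm forms cut out a FINITE set, `V(𝔮)` is infinite;
if `xᵢ ∈ 𝔮` every distance is `≥ 1` and the claim is trivial); fibres of `σ ↦ σ(y)` have size
`[K:ℚ(y)] ≤ δₛ` (metric Bézout `deg(𝔮 + (N)) ≤ δₛ·deg N` + ZDD (A),(B′)); affine cluster
`|σy − x| ≤ 2·projDist` in the chart; LANDED `OrbitClusterBound` at `t = 1` for `ℚ(y)` (spanning free,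
`h_{ℚ(y)}(1:y)·[K:ℚ(y)] = h_K(bᵢ:bⱼ) ≤ h_K(b) ≤ h(𝔭) + cD` by ZDD (C) + `logHeight_comp_algebraMap`):
`k(a) ≤ max(8δₛ, D√(C'(h̄+1)/a))`; layer cake `Σ_σ a_σ = ∫ k(a) da` (k2 H3, pure ℝ); ZDD (D). -/
def OrbitFloor : Prop :=
  ∀ ω : Fin 3 → ℂ, ∃ C : ℝ, 0 < C ∧
    ∀ (𝔭 𝔮 : Ideal (Rx 3)) (L : ℝ), 𝔭.IsPrime → 𝔭.IsHomogeneous (homogeneousSubmodule (Fin (3 + 1)) ℚ) →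
      IsUnmixedOfRank 𝔭 1 → 𝔮.IsPrime → 𝔮.IsHomogeneous (homogeneousSubmodule (Fin (3 + 1)) ℚ) →
      IsUnmixedOfRank 𝔮 2 → 𝔮 ≤ 𝔭 → 1 ≤ L →
      (∀ β ∈ projZeros 𝔭, Real.exp (-L) ≤ projDist (Fin.cons 1 ω) β) →
      Real.log (1 / iabs 𝔭 1 (Fin.cons 1 ω)) ≤
        C * ((ideg 𝔮 2 : ℝ) * L + iheight 𝔭 1 + (ideg 𝔭 1 : ℝ) * Real.log ((ideg 𝔭 1 : ℝ) + 2) +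
          Real.sqrt ((ideg 𝔭 1 : ℝ) * (iheight 𝔭 1 + ideg 𝔭 1) * L))

theorem stub_orbitFloor : OrbitFloor := by
  sorry

/-- **P2-ℝ `floor_arith`** (S, pure real bookkeeping used by the assembly; numerically sampled).
From the floor inequality with `S ≥ D(Δh̄ + Y)/c_d` one extracts
`L ≥ Δ (Δ h̄ + Y) / (16 C² c_d²)` once `Δ ≥ 8 C c_d`, `Y ≥ 8 C c_d log(D+2)`, `D ≥ Δ δₛ/(4 C c_d)`. -/
theorem floor_arith (C cd Δ Y D hbar L δ : ℝ) (hC : 1 ≤ C) (hcd : 1 ≤ cd) (hΔ : 8 * C * cd ≤ Δ)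
    (hY : Δ ≤ Y) (hlog : 8 * C * cd * Real.log (D + 2) ≤ Y) (hD : 1 ≤ D) (hh : 0 ≤ hbar)
    (hδ : 1 ≤ δ) (hDδ : Δ * δ ≤ 4 * C * cd * D) (hL : 1 ≤ L)
    (hfloor : D * (Δ * hbar + Y) / cd ≤
      C * (δ * L + D * hbar + D * Real.log (D + 2) + Real.sqrt (D * (D * hbar + D) * L))) :
    Δ * (Δ * hbar + Y) / (16 * C ^ 2 * cd ^ 2) ≤ L := by
  sorry

/-! ## Tier 1 — P3: height of a satellite carrying a long orbit (k1 H7; lines = k2 H4b) -/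

/-- **P3 `SatelliteHeightLine`** (S–M).  A rational LINE `V(𝔩)` (`ideg 𝔩 2 = 1`) carrying an orbit of
`D ≥ 2` points has `h(𝔩) ≤ C (h(𝔭)/D + 1)`: Plücker vector `∝ σ₁b ∧ σ₂b`, `h(x ∧ y) ≤ h(x)+h(y)+log 2`,
conjugates equi-high, ZDD (C) (`h_K(b) ≤ h(𝔭) + cD`, ABSOLUTE normalisation `/D` is load-bearing);
`iheight 𝔩 2 ≤ h(L₁) + h(L₂) + O(1)` for the two dual-Plücker linear forms (Props 4.8/4.11/4.7 HOLD). -/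
def SatelliteHeightLine : Prop :=
  ∃ C : ℝ, 0 < C ∧ ∀ (𝔭 𝔩 : Ideal (Rx 3)), 𝔭.IsPrime →
    𝔭.IsHomogeneous (homogeneousSubmodule (Fin (3 + 1)) ℚ) → IsUnmixedOfRank 𝔭 1 → 𝔩.IsPrime →
    𝔩.IsHomogeneous (homogeneousSubmodule (Fin (3 + 1)) ℚ) → IsUnmixedOfRank 𝔩 2 → ideg 𝔩 2 = 1 →
    𝔩 ≤ 𝔭 → 2 ≤ ideg 𝔭 1 →
    iheight 𝔩 2 ≤ C * (iheight 𝔭 1 / ideg 𝔭 1 + 1)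

theorem stub_satelliteHeightLine : SatelliteHeightLine := by
  sorry

/-- **P3′ `SatelliteHeight`** (M–L, Tier 2).  General degree `δ`: for `D > 2δ²` the degree-`2δ` part of
`𝔮` is cut out by the orbit (`F(σb) = 0 ∀σ ⇒ F ∈ 𝔮` by metric Bézout, cf. `line_subset_of_collinear_orbit`),
the `ℚ`-subspace `𝔮_{2δ}` has height `≤ (2δ²+1)(2δ h̄ + log N)` (Hadamard on `H(𝔮;2δ)` independent
evaluation rows), its Cramer/dual-Plücker spanning vectors are INTEGER forms of that height (no Siegel
lemma needed), two of them `F₁ ∋` an irreducible `G ∈ 𝔮`, `F₂ ∉ (G)` (exists since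
`H((G);2δ) ≥ (2δ+1)(2δ+2)/2 > δ(2δ+1) ≥ H(𝔮;2δ)`), and Props 4.8/4.11/4.7 bound `h(𝔮)`. -/
def SatelliteHeight : Prop :=
  ∀ δ : ℕ, 1 ≤ δ → ∃ C : ℝ, 0 < C ∧ ∀ (𝔭 𝔮 : Ideal (Rx 3)), 𝔭.IsPrime →
    𝔭.IsHomogeneous (homogeneousSubmodule (Fin (3 + 1)) ℚ) → IsUnmixedOfRank 𝔭 1 → 𝔮.IsPrime →
    𝔮.IsHomogeneous (homogeneousSubmodule (Fin (3 + 1)) ℚ) → IsUnmixedOfRank 𝔮 2 → ideg 𝔮 2 = δ →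
    𝔮 ≤ 𝔭 → 2 * δ ^ 2 < ideg 𝔭 1 →
    iheight 𝔮 2 ≤ C * (iheight 𝔭 1 / ideg 𝔭 1 + 1)

theorem stub_satelliteHeight : SatelliteHeight := by
  sorry

/-! ## Tier 1 — P4: restart on a close container, directly in `ℙ³` (k1 H4, restated) -/

/-- **P4 `ContainerRestart`** (M).  A `ℚ`-curve `V(𝔮)` on the c.i. `(Q, R)` (`a + b ≤ 3Δ`; gives
`H(𝔮; 4⌊Δ⌋) ≥ (4⌊Δ⌋ − a − b)·deg 𝔮` by LANDED `curveOnCI_hilbertLowerBound`) passing within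
`exp(−C(Δ/c + 1)(Δ h(𝔮) + Y deg 𝔮))` of `ω̄` is re-cut in degree `4⌊Δ⌋` by a small `F ∉ 𝔮`
(LANDED `boxPrinciple_modIdeal`) and `small_prime_of_cut` (LANDED, `r = 2`, weights `(Δ, Y)`), the
container's own value being `|𝔮(ω̄)| ≤ ρ e^{45 deg 𝔮}` (tree `NesterenkoPhilippon2001_ch3_cor_4_10_holds`).
Output: a prime orbit `𝔯 ⊇ 𝔮` meeting the `CycleAPIAt 3` matrix with constant `c`; its clause at
`⌊cΔ⌋` is AUTOMATIC when `4Δ deg 𝔮 ≤ ⌊cΔ⌋ + 1` (`rankOne_interpolation_of_ideg_le`, LANDED).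
The threshold's height term is why P3 is needed (the construction bound `h(𝔮) ≲ c_d ΔY` from Prop 4.7
on `J₂` is too weak by a factor `Δ c_d³`). -/
def ContainerRestart : Prop :=
  ∀ ω : Fin 3 → ℂ, ∃ C : ℝ, 1 ≤ C ∧
    ∀ (Q R : Rx 3) (a b : ℕ) (𝔮 : Ideal (Rx 3)),
      Q ≠ 0 → Q.IsHomogeneous a → R.IsHomogeneous b → 1 ≤ a → 1 ≤ b →
      (Ideal.span {Q}).IsPrime → R ∉ Ideal.span {Q} →
      𝔮.IsPrime → 𝔮.IsHomogeneous (homogeneousSubmodule (Fin (3 + 1)) ℚ) → IsUnmixedOfRank 𝔮 2 →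
      Q ∈ 𝔮 → R ∈ 𝔮 →
    ∀ (c Δ Y : ℝ), C ≤ c → c ≤ Δ → Δ ≤ Y → (a : ℝ) + b ≤ 3 * Δ →
      rho (Fin.cons 1 ω) 𝔮 ≤ Real.exp (-(C * (Δ / c + 1) * (Δ * iheight 𝔮 2 + Y * ideg 𝔮 2))) →
      ∃ 𝔯 : Ideal (Rx 3), 𝔯.IsPrime ∧ 𝔯.IsHomogeneous (homogeneousSubmodule (Fin (3 + 1)) ℚ) ∧
        IsUnmixedOfRank 𝔯 1 ∧ 𝔮 ≤ 𝔯 ∧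
        (ideg 𝔯 1 : ℝ) ≤ 4 * Δ * ideg 𝔮 2 ∧
        iheight 𝔯 1 ≤ C * (Δ * iheight 𝔮 2 + Y * ideg 𝔮 2) ∧
        iabs 𝔯 1 (Fin.cons 1 ω) ≤ Real.exp (-((Δ * iheight 𝔯 1 + Y * ideg 𝔯 1) / c))

theorem stub_containerRestart : ContainerRestart := by
  sorry

/-- **P4-ℝ `restart_threshold_arith`** (S, pure real; numerically sampled): the floor beats the
restart threshold for containers of degree `δ ≤ δ⋆` and height `≤ p (h̄ + 1)` once
`c_f ≥ 16 C C₁ c_d² (p + 1) δ` and `Δ ≥ c_f`. -/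
theorem restart_threshold_arith (C C₁ cd cf Δ Y hbar hq δ p L : ℝ) (hC : 1 ≤ C) (hC₁ : 1 ≤ C₁)
    (hcd : 1 ≤ cd) (hp : 1 ≤ p) (hδ : 1 ≤ δ) (hcf : 16 * C * C₁ * cd ^ 2 * (p + 1) * δ ≤ cf)
    (hΔ : cf ≤ Δ) (hY : Δ ≤ Y) (hh : 0 ≤ hbar) (hhq : hq ≤ p * (hbar + 1))
    (hL : Δ * (Δ * hbar + Y) / (C₁ * cd ^ 2) ≤ L) :
    C * (Δ / cf + 1) * (Δ * hq + Y * δ) ≤ L := by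
  sorry

/-! ## Tier 1′ — P5: the GOOD case as a NAMED FACT (Chardin–Philippon 1999, dimension 0) -/

/-- **P5 `ChardinPhilippon1999Dim0`** — to be vendored as a Literature named fact
(`def … : Prop` with cite `[ChardinPhilippon1999, Thm. (dim 0)]`, erratum J. Algebraic Geom. 11
(2002) 599–600 to be READ before filing; acq-06248): the ISOLATED points (minimal primes of rank 1)
of a scheme cut out by forms of degree `≤ δ₀` in `ℙᵐ` impose independent conditions on forms of every
degree `ν ≥ m(δ₀ − 1) + 1` (the safe side of `d₁ + ⋯ + d_m − m`).  Discharging it is XL (local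
cohomology / liaison) and is SHARED with line `arithmetic-chardin-philippon` (`r = 1` sharpening of
`stub_geomHilbertLB`).  No elementary substitute is known to this seat for the sub-case "isolated but
`ν`-enveloped by a satellite" (k3's L2/L3 give the rest unconditionally). -/
def ChardinPhilippon1999Dim0 : Prop :=
  ∀ (m k δ₀ : ℕ), 1 ≤ m → ∀ (g : Fin k → Rx m) (e : Fin k → ℕ),
    (∀ j, (g j).IsHomogeneous (e j) ∧ 1 ≤ e j ∧ e j ≤ δ₀) →
    ∀ 𝔮 : Ideal (Rx m), 𝔮.IsPrime → 𝔮.IsHomogeneous (homogeneousSubmodule (Fin (m + 1)) ℚ) →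
      IsUnmixedOfRank 𝔮 1 → 𝔮 ∈ (Ideal.span (Set.range g)).minimalPrimes →
      ∀ ν : ℕ, m * (δ₀ - 1) + 1 ≤ ν →
        Module.finrank ℚ ↥(homogeneousSubmodule (Fin (m + 1)) ℚ ν) =
          Module.finrank ℚ ↥(homogeneousSubmodule (Fin (m + 1)) ℚ ν ⊓ 𝔮.restrictScalars ℚ) +
            ideg 𝔮 1

/-! ## Tier 1 — P7: satellite restart, composed (k2's `LineRestart` shape, degree `≤ δ⋆`) -/

/-- **P7 `SatelliteRestart δ⋆`** — TWO constants, explicitly: for every descent constant `c` there is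
a certification constant `c' ≥ c` such that a `c`-qualifying orbit that is TOO LONG for the automatic
clause (`⌊c'Δ⌋ + 1 < deg 𝔭`) and lies on a satellite `V(𝔮)` of the c.i. `(Q, R)` of degree `≤ δ⋆` is
REPLACED by a cycle meeting the full `CycleAPIAt 3` conclusion at `c'`.
`satelliteRestart_of`: P2 (floor, both branches) + P3/P3′ (container height from the orbit) + P4
(restart) + `rankOne_interpolation_of_ideg_le` + the two ℝ-lemmas; `c' = K · c² · (p(δ⋆)+1) · δ⋆`. -/
def SatelliteRestart (δstar : ℕ) : Prop :=
  ∀ ω : Fin 3 → ℂ, ∀ c : ℝ, 1 ≤ c → ∃ c' : ℝ, c ≤ c' ∧ ∀ Δ Y : ℝ, c' ≤ Δ → Δ ≤ Y →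
    ∀ (Q R : Rx 3) (a b : ℕ) (𝔮 𝔭 : Ideal (Rx 3)),
      Q ≠ 0 → Q.IsHomogeneous a → R.IsHomogeneous b → 1 ≤ a → 1 ≤ b → (a : ℝ) + b ≤ 3 * Δ →
      (Ideal.span {Q}).IsPrime → R ∉ Ideal.span {Q} →
      𝔮.IsPrime → 𝔮.IsHomogeneous (homogeneousSubmodule (Fin (3 + 1)) ℚ) → IsUnmixedOfRank 𝔮 2 →
      Q ∈ 𝔮 → R ∈ 𝔮 → ideg 𝔮 2 ≤ δstar →
      𝔭.IsPrime → 𝔭.IsHomogeneous (homogeneousSubmodule (Fin (3 + 1)) ℚ) → IsUnmixedOfRank 𝔭 1 →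
      𝔮 ≤ 𝔭 → ⌊c' * Δ⌋₊ + 1 < ideg 𝔭 1 →
      (ideg 𝔭 1 : ℝ) ≤ (c * Δ) ^ 3 → iheight 𝔭 1 ≤ c * Y * Δ ^ 2 →
      iabs 𝔭 1 (Fin.cons 1 ω) ≤ Real.exp (-((Δ * iheight 𝔭 1 + Y * ideg 𝔭 1) / c)) →
      ∃ I : Ideal (Rx 3), I.IsHomogeneous (homogeneousSubmodule (Fin (3 + 1)) ℚ) ∧
        IsUnmixedOfRank I 1 ∧
        (ideg I 1 : ℝ) ≤ (c' * Δ) ^ 3 ∧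
        iheight I 1 ≤ c' * Y * Δ ^ (3 - 1) ∧
        iabs I 1 (Fin.cons 1 ω) ≤ Real.exp (-((Δ * iheight I 1 + Y * ideg I 1) / c')) ∧
        ∀ 𝔯 ∈ I.associatedPrimes,
          Module.finrank ℚ ↥(homogeneousSubmodule (Fin (3 + 1)) ℚ ⌊c' * Δ⌋₊) =
            Module.finrank ℚ ↥(homogeneousSubmodule (Fin (3 + 1)) ℚ ⌊c' * Δ⌋₊ ⊓ 𝔯.restrictScalars ℚ) +
              ideg 𝔯 1

/-- Lines only (`δ⋆ = 1`): the fully-tooled case (B1). -/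
theorem satelliteRestart_one_of (hF : OrbitFloor) (hH : SatelliteHeightLine) (hR : ContainerRestart) :
    SatelliteRestart 1 := by
  sorry

/-- Bounded degree (B2): the same composition with P3′. -/
theorem satelliteRestart_of (δstar : ℕ) (hF : OrbitFloor) (hH : SatelliteHeight)
    (hR : ContainerRestart) : SatelliteRestart δstar := by
  sorry

/-! ## P6 — the RESIDUAL, typed (OPEN; disprover target; NOT implied by the stub, not a costume) -/

/-- **P6 `NoFarBadSatellite δ⋆`** — "far satellites are never BAD": a `c`-qualifying orbit too long
for the automatic clause at `c'` that lies on a satellite of the c.i. `(Q,R)` of degree `> δ⋆` DOES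
satisfy the clause at `⌊c'Δ⌋`.  OPEN: no ideator, siege seat or this critic has an argument; k1's
liaison count (Chardin–Ulrich / Peskine–Szpiro) shows a failure needs the satellite `C'` to be a
NEGATIVE curve on the (Noether–Lefschetz special) surface `S = V(Q)` of degree `a > c' − 1`, cut out by
`R` with multiplicity `μ > (c' − 7)Δ/(a − 2)`, `deg C' < 2a(a−2)/(c' − 7)`, and `ω̄` within
`exp(−Δ(Δh̄+Y)/(C₁c²))` of `C'` (P2); the point/cycle extraction for such an orbit is Philippon's
open AP2 at `n = 3` in this line's currency.  If REFUTED (a satellite-Liouville `ω`), the LINE must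
change (clause ↦ "clause ∨ named envelope", envelope-aware extraction), not just this stub. -/
def NoFarBadSatellite (δstar : ℕ) : Prop :=
  ∀ ω : Fin 3 → ℂ, ∀ c : ℝ, 1 ≤ c → ∃ c' : ℝ, c ≤ c' ∧ ∀ Δ Y : ℝ, c' ≤ Δ → Δ ≤ Y →
    ∀ (Q R : Rx 3) (a b : ℕ) (𝔮 𝔭 : Ideal (Rx 3)),
      Q ≠ 0 → Q.IsHomogeneous a → R.IsHomogeneous b → 1 ≤ a → 1 ≤ b → (a : ℝ) + b ≤ 3 * Δ →
      (Ideal.span {Q}).IsPrime → R ∉ Ideal.span {Q} →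
      𝔮.IsPrime → 𝔮.IsHomogeneous (homogeneousSubmodule (Fin (3 + 1)) ℚ) → IsUnmixedOfRank 𝔮 2 →
      Q ∈ 𝔮 → R ∈ 𝔮 → δstar < ideg 𝔮 2 →
      𝔭.IsPrime → 𝔭.IsHomogeneous (homogeneousSubmodule (Fin (3 + 1)) ℚ) → IsUnmixedOfRank 𝔭 1 →
      𝔮 ≤ 𝔭 → ⌊c' * Δ⌋₊ + 1 < ideg 𝔭 1 →
      (ideg 𝔭 1 : ℝ) ≤ (c * Δ) ^ 3 → iheight 𝔭 1 ≤ c * Y * Δ ^ 2 →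
      iabs 𝔭 1 (Fin.cons 1 ω) ≤ Real.exp (-((Δ * iheight 𝔭 1 + Y * ideg 𝔭 1) / c)) →
      Module.finrank ℚ ↥(homogeneousSubmodule (Fin (3 + 1)) ℚ ⌊c' * Δ⌋₊) =
        Module.finrank ℚ ↥(homogeneousSubmodule (Fin (3 + 1)) ℚ ⌊c' * Δ⌋₊ ⊓ 𝔭.restrictScalars ℚ) +
          ideg 𝔭 1

/-! ## The assembly (shape; the kernel-checked composition is the lead's) -/

/-- **`CycleAPIAt3_of`** — the stub from: P1 (data) + P0a/P0b + `rankOne_interpolation_of_ideg_le`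
(LANDED) + P5 (good case, named fact) + P7 (satellite restart, degree `≤ δ⋆`) + P6 (residual).
Constants: run P1 at `c_d = c_d(ω)`; `c_f := max (c'_{P7}(c_d), c'_{P6}(c_d), 12, Δ₀(c_d))`; every
occurrence of `c` in `CycleAPIAt` is monotone (budgets grow, accuracy weakens, clause level rises:
P0a), so a `c_d`-output certified at any `c ≤ c_f` is a `c_f`-output.  Case tree on the P1 orbit `𝔭`:
(G0) `deg 𝔭 ≤ ⌊c_fΔ⌋ + 1` → automatic; (G1) `𝔭` minimal over `(Q,P,T)` → P5 at level
`3(4Δ−1)+1 ≤ 12Δ ≤ c_fΔ` → P0a; (B) `𝔭 > 𝔮' ⊇ (Q,P,T)` satellite (P0b): `deg 𝔮' ≤ δ⋆` → P7,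
else → P6 → P0a. -/
theorem CycleAPIAt3_of (δstar : ℕ) (hδ : 1 ≤ δstar) (hData : CycleAP3Data)
    (hCP : ChardinPhilippon1999Dim0) (hSR : SatelliteRestart δstar)
    (hNFS : NoFarBadSatellite δstar) : CycleAPIAt 3 := by
  sorry

end StubPlanCycleAPIAt3
end Summit.Schanuel.Schanuel.Cruxes.ApproximationProperty.OrbitInterpolationDeterminant

end
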